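import Mathlib
import Summits.KontsevichZagierPeriods.Zeta5Search.CellKitPoints
import HarnessLib

/-!
# ζ(5) search — CELL KIT, part 6: the centre condition of a level class as ONE linear equation

Cell `pub-zeta5` (HONEST FRAMING: systematic search; no irrationality claim unless certified), P1 prover seat generation 8.
For a residue class `{x, x+p, …, x+Lp}` (`x < p`, `x + Lp ≤ b₀ < x + (L+1)p`) the centre condition `CentreIn b p x`
(`∃ k ≤ L, 2x + kp = b₀`, `CellKitLevel.centreIn_iff_level`) can only be realised at `k = L`, because `x < p`:
`CentreIn b p x ↔ 2x + Lp = b₀` (`centreIn_iff_last`).  The machine-generated cell atlases (generation 8) use this single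
equation instead of the `L + 1`-fold disjunction of the ray layers, which keeps the `omega` certificates small.
Combinatorics only; nothing about irrationality.
-/

noncomputable section

namespace Summit.KontsevichZagierPeriods.Zeta5Search.CellKit

open Summit.KontsevichZagierPeriods.Zeta5Search.ClusterValuation (netExp classSet CentreIn classExp)
open Summit.KontsevichZagierPeriods.Zeta5Search.LevelClass

variable {p : ℕ} [hp : Fact p.Prime]

/-- **The centre condition of a level class is the single equation `2x + Lp = b₀`** (the centre, if in the class at all,
sits at the last admissible position). -/
theorem centreIn_iff_last (b : ℕ → ℤ) {x L : ℕ} (hx : x < p) (hL : x + L * p ≤ (b 0).toNat)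
    (hL' : (b 0).toNat < x + L * p + p) (h0 : 0 ≤ b 0) : CentreIn b p x ↔ 2 * x + L * p = (b 0).toNat := by
  rw [centreIn_iff_level b hx hL hL' h0]
  constructor
  · rintro ⟨k, hk, h⟩
    rcases Nat.lt_or_ge k L with hlt | hge
    · exfalso
      have h1 : k * p + p ≤ L * p := by
        have := Nat.mul_le_mul_right p hlt
        rwa [Nat.succ_mul] at this
      omega
    · have hkL : k = L := le_antisymm hk hge
      rw [hkL] at h
      exact h
  · intro h
    exact ⟨L, le_rfl, h⟩

end Summit.KontsevichZagierPeriods.Zeta5Search.CellKit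

end
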